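import Summits.NavierStokesRegularity.NavierStokesRegularity.Theorems.FilamentSkeletonRssDefectColumnGateBorderedAssembly

/-!
# Route `FilamentSkeletonRss` · ∀-support item `TransverseReduction1ARmod` (stmt-NavierStokesRegularity-23920) · line `defect_column_gate_1AR_mod`,
# stub S2b-mod `GateAssemblyLocMod`: the assembly interface WITH ITS RANGE STRUCTURE EXPOSED

Helper file (theorems only), `--supports stmt-NavierStokesRegularity-23920 --as helper` (also serves 23611); LEAD of 23611 / registrar of 23920,
lane ns-filament-21221-p1 g14.

`defectGateSpecAcc_of_approximate` (p681316) hides the constructed gate behind `∃ (𝓚, 𝓠, 𝓫, 𝓬)`.  For the CONTINUITY METHOD of S2b-mod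
(`…DefectColumnGateHomotopy.lean`: free bordered gate + uniform a-priori bound along a base homotopy ⇒ gate at the dressed base) one needs to know
that the new gate is the OLD approximate gate PRECOMPOSED with a Y-bounded data map — so that every RANGE property of the old pieces
(co-border / normalisation conditions `ℓ_i(K₀G) = 0`, pressure normalisation, support or symmetry of outputs) transfers to the new gate verbatim.
`defectGateSpecAcc_of_approximate_range` is p681316 with exactly that conclusion: `∃ Nop`, `Y(Nop F) ≤ 2·Y(F)` on the box, and
`DefectGateSpecAcc … (K₀ ∘ Nop) (Q₀ ∘ Nop) (𝓫₀ ∘ Nop) (𝓬₀ ∘ Nop)`.  The proof is p681316's, with the witness kept.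
HONEST FRAMING: functional-analytic bookkeeping for a HYPOTHETICAL filament-type rotating-self-similar blow-up route (MODEL rung, negative side, SUPPORT
item); the ANALYTIC content of S2b-mod is untouched and OPEN; nothing here bears on Navier–Stokes regularity, which is NOT proved.
-/

set_option linter.dupNamespace false

noncomputable section

namespace Summit.NavierStokesRegularity.NavierStokesRegularity.Theorems.DefectColumnGate

open scoped BigOperators Topology InnerProductSpace ContDiff
open Filter Set Function MeasureTheory Metric
open Literature.Analysis.FluidPDE
open Summit.NavierStokesRegularity.NavierStokesRegularity.Theorems.KelvinGate

/-- **S2b ASSEMBLY INTERFACE, range form.**  Same hypotheses as `defectGateSpecAcc_of_approximate` (an approximate gate `(K₀, Q₀, 𝓫₀, 𝓬₀)` bordered by `Z`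
and `D_{p,1…N}` with a Y-contracting, linear, tight, locally continuous defect `R`); conclusion: a data map `Nop` on the box with `Y(Nop F) ≤ 2·Y(F)` such that
the PRECOMPOSED pieces `(K₀ ∘ Nop, Q₀ ∘ Nop, 𝓫₀ ∘ Nop, 𝓬₀ ∘ Nop)` satisfy `DefectGateSpecAcc N Γ κ C₂ β₀ α0 U0 Z D`. -/
theorem defectGateSpecAcc_of_approximate_range {N : ℕ} {Γ κ C₂ β₀ A θ : ℝ} {α0 : (Fin N → ℝ) → ℝ}
    {U0 : (Fin N → ℝ) → ℝ → EuclideanSpace ℝ (Fin 3) → EuclideanSpace ℝ (Fin 3)} {Z : (Fin N → ℝ) → ℝ → EuclideanSpace ℝ (Fin 3) → EuclideanSpace ℝ (Fin 3)}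
    {D : (Fin N → ℝ) → Fin N → EuclideanSpace ℝ (Fin 3) → EuclideanSpace ℝ (Fin 3)}
    (K₀ Rm : (Fin N → ℝ) → ℝ → (EuclideanSpace ℝ (Fin 3) → EuclideanSpace ℝ (Fin 3)) → EuclideanSpace ℝ (Fin 3) → EuclideanSpace ℝ (Fin 3))
    (Q₀ : (Fin N → ℝ) → ℝ → (EuclideanSpace ℝ (Fin 3) → EuclideanSpace ℝ (Fin 3)) → EuclideanSpace ℝ (Fin 3) → ℝ)
    (𝓫₀ : (Fin N → ℝ) → ℝ → (EuclideanSpace ℝ (Fin 3) → EuclideanSpace ℝ (Fin 3)) → ℝ)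
    (𝓬₀ : (Fin N → ℝ) → ℝ → (EuclideanSpace ℝ (Fin 3) → EuclideanSpace ℝ (Fin 3)) → Fin N → ℝ)
    (hA : 2 * A ≤ C₂ * Γ ^ κ) (hθ : θ ≤ 1 / 2)
    (h1 : ∀ p : Fin N → ℝ, (∀ i, p i ∈ Icc (0:ℝ) 1) → ∀ β : ℝ, |β| ≤ β₀ → ∀ (F : EuclideanSpace ℝ (Fin 3) → EuclideanSpace ℝ (Fin 3)) (R : ℝ), YBound F R →
      XBound (K₀ p β F) (A * R) ∧ ContDiff ℝ 1 (Q₀ p β F) ∧ (∀ y, |Q₀ p β F y| ≤ A * R) ∧ |𝓫₀ p β F| ≤ A * R ∧ (∀ j, |𝓬₀ p β F j| ≤ A * R) ∧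
      VectorCalculus.IsDivFree (K₀ p β F) ∧ YBound (Rm p β F) (θ * R) ∧
      ∀ y, lerayLin (α0 p + β) (U0 p β) (K₀ p β F) y + gradient (Q₀ p β F) y + 𝓫₀ p β F • Z p β y + ∑ j, 𝓬₀ p β F j • D p j y + Rm p β F y = F y)
    (h2 : ∀ p : Fin N → ℝ, (∀ i, p i ∈ Icc (0:ℝ) 1) → ∀ β : ℝ, |β| ≤ β₀ → ∀ (F H : EuclideanSpace ℝ (Fin 3) → EuclideanSpace ℝ (Fin 3)) (s : ℝ),
      (∃ R, YBound F R) → (∃ R, YBound H R) →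
      (K₀ p β (fun y => F y + s • H y) = fun y => K₀ p β F y + s • K₀ p β H y) ∧ 𝓫₀ p β (fun y => F y + s • H y) = 𝓫₀ p β F + s * 𝓫₀ p β H ∧
      (∀ j, 𝓬₀ p β (fun y => F y + s • H y) j = 𝓬₀ p β F j + s * 𝓬₀ p β H j) ∧ (Rm p β (fun y => F y + s • H y) = fun y => Rm p β F y + s • Rm p β H y))
    (h3 : ∀ R L ε : ℝ, 0 < ε → ∃ L' δ₀ : ℝ, 0 < δ₀ ∧ ∀ p : Fin N → ℝ, (∀ i, p i ∈ Icc (0:ℝ) 1) → ∀ β : ℝ, |β| ≤ β₀ →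
      ∀ F : EuclideanSpace ℝ (Fin 3) → EuclideanSpace ℝ (Fin 3), YBound F R → (∀ y, ‖y‖ ≤ L' → ‖F y‖ ≤ δ₀) →
        (∀ y, ‖y‖ ≤ L → ‖K₀ p β F y‖ ≤ ε ∧ ‖fderiv ℝ (K₀ p β F) y‖ ≤ ε) ∧ |𝓫₀ p β F| ≤ ε ∧ (∀ j, |𝓬₀ p β F j| ≤ ε) ∧ (∀ y, ‖y‖ ≤ L → ‖Rm p β F y‖ ≤ ε))
    (h4 : ∀ p : Fin N → ℝ, (∀ i, p i ∈ Icc (0:ℝ) 1) → ∀ β : ℝ, |β| ≤ β₀ → ∀ (F : EuclideanSpace ℝ (Fin 3) → EuclideanSpace ℝ (Fin 3)) (R L ε : ℝ),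
      YBound F R → 0 < ε → ∃ δ' : ℝ, 0 < δ' ∧ ∀ p' : Fin N → ℝ, (∀ i, p' i ∈ Icc (0:ℝ) 1) → ∀ β' : ℝ, |β'| ≤ β₀ → dist p' p < δ' → |β' - β| < δ' →
        LocClose (K₀ p' β' F) (K₀ p β F) L ε ∧ |𝓫₀ p' β' F - 𝓫₀ p β F| ≤ ε ∧ (∀ j, |𝓬₀ p' β' F j - 𝓬₀ p β F j| ≤ ε) ∧
        (∀ y, ‖y‖ ≤ L → ‖Rm p' β' F y - Rm p β F y‖ ≤ ε)) :
    ∃ Nop : ((Fin N → ℝ) × ℝ) → (EuclideanSpace ℝ (Fin 3) → EuclideanSpace ℝ (Fin 3)) → EuclideanSpace ℝ (Fin 3) → EuclideanSpace ℝ (Fin 3),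
      (∀ p : Fin N → ℝ, (∀ i, p i ∈ Icc (0:ℝ) 1) → ∀ β : ℝ, |β| ≤ β₀ →
        ∀ (F : EuclideanSpace ℝ (Fin 3) → EuclideanSpace ℝ (Fin 3)) (R : ℝ), YBound F R → YBound (Nop (p, β) F) (2 * R)) ∧
      DefectGateSpecAcc N Γ κ C₂ β₀ α0 U0 Z D (fun p β F => K₀ p β (Nop (p, β) F)) (fun p β F => Q₀ p β (Nop (p, β) F))
        (fun p β F => 𝓫₀ p β (Nop (p, β) F)) (fun p β F => 𝓬₀ p β (Nop (p, β) F)) := by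
  classical
  -- shorthand: the parameter set and its bookkeeping
  set cube : Set (Fin N → ℝ) := {p : Fin N → ℝ | ∀ i, p i ∈ Icc (0:ℝ) 1} with hcube
  set S : Set ((Fin N → ℝ) × ℝ) := cube ×ˢ Icc (-β₀) β₀ with hS
  have hSm : ∀ π : (Fin N → ℝ) × ℝ, π ∈ S → (∀ i, π.1 i ∈ Icc (0:ℝ) 1) ∧ |π.2| ≤ β₀ := fun π hπ => (mem_cubeWindow_iff π).mp hπ
  have hSm' : ∀ (p : Fin N → ℝ) (β : ℝ), (∀ i, p i ∈ Icc (0:ℝ) 1) → |β| ≤ β₀ → ((p, β) : (Fin N → ℝ) × ℝ) ∈ S :=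
    fun p β hp hβ => (mem_cubeWindow_iff (p, β)).mpr ⟨hp, hβ⟩
  -- the Neumann data `T := −R` at each parameter
  have hR1 : ∀ π ∈ S, ∀ (G : EuclideanSpace ℝ (Fin 3) → EuclideanSpace ℝ (Fin 3)) (S' : ℝ), YBound G S' → YBound (Rm π.1 π.2 G) (θ * S') :=
    fun π hπ G S' hG => ((h1 π.1 (hSm π hπ).1 π.2 (hSm π hπ).2) G S' hG).2.2.2.2.2.2.1
  have hR2 : ∀ π ∈ S, ∀ (F G : EuclideanSpace ℝ (Fin 3) → EuclideanSpace ℝ (Fin 3)) (s : ℝ), (∃ S', YBound F S') → (∃ S', YBound G S') →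
      Rm π.1 π.2 (fun y => F y + s • G y) = fun y => Rm π.1 π.2 F y + s • Rm π.1 π.2 G y :=
    fun π hπ F G s hF hG => ((h2 π.1 (hSm π hπ).1 π.2 (hSm π hπ).2) F G s hF hG).2.2.2
  have hT1 : ∀ π ∈ S, ∀ (G : EuclideanSpace ℝ (Fin 3) → EuclideanSpace ℝ (Fin 3)) (S' : ℝ), YBound G S' → YBound (fun y => -Rm π.1 π.2 G y) (θ * S') :=
    fun π hπ G S' hG => (hR1 π hπ G S' hG).neg
  have hT2 : ∀ π ∈ S, ∀ (G H : EuclideanSpace ℝ (Fin 3) → EuclideanSpace ℝ (Fin 3)) (s : ℝ), (∃ S', YBound G S') → (∃ S', YBound H S') →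
      (fun y => -Rm π.1 π.2 (fun y => G y + s • H y) y) = fun y => -Rm π.1 π.2 G y + s • -Rm π.1 π.2 H y := by
    intro π hπ G H s hG hH
    have h := hR2 π hπ G H s hG hH
    funext y; rw [h]; simp only [smul_neg]; abel
  -- the solution operators, one per parameter (junk outside `S`)
  have hsol : ∀ π : (Fin N → ℝ) × ℝ, π ∈ S → ∀ F : EuclideanSpace ℝ (Fin 3) → EuclideanSpace ℝ (Fin 3),
      ∃ G : EuclideanSpace ℝ (Fin 3) → EuclideanSpace ℝ (Fin 3),
        (∀ R, YBound F R → YBound G (2 * R)) ∧ (∀ R, YBound F R → ∀ y, G y = F y - (fun G y => -Rm π.1 π.2 G y) G y) :=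
    fun π hπ F => neumann_solution (T := fun G y => -Rm π.1 π.2 G y) (hT1 π hπ) (hT2 π hπ) hθ F
  choose! Nop hN1 hN2' using hsol
  have hN2 : ∀ π ∈ S, ∀ (F : EuclideanSpace ℝ (Fin 3) → EuclideanSpace ℝ (Fin 3)) (S' : ℝ), YBound F S' → ∀ y, Nop π F y = F y + Rm π.1 π.2 (Nop π F) y := by
    intro π hπ F S' hF y
    have h := hN2' π hπ F S' hF y
    rw [h]; simp only [sub_neg_eq_add]
  have hNlin : ∀ π ∈ S, ∀ (F H : EuclideanSpace ℝ (Fin 3) → EuclideanSpace ℝ (Fin 3)) (s : ℝ), (∃ S', YBound F S') → (∃ S', YBound H S') →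
      Nop π (fun y => F y + s • H y) = fun y => Nop π F y + s • Nop π H y :=
    fun π hπ => neumann_linear (T := fun G y => -Rm π.1 π.2 G y) (hT1 π hπ) (hT2 π hπ) hθ (S := Nop π) (fun F R hF => hN1 π hπ F R hF)
      (fun F R hF => hN2' π hπ F R hF)
  -- tightness (values) and local continuity of the solution operators (`…NeumannParam`)
  have hR3 : ∀ R₁ L t : ℝ, 0 < t → ∃ L' δ₀ : ℝ, 0 < δ₀ ∧ ∀ π ∈ S, ∀ F : EuclideanSpace ℝ (Fin 3) → EuclideanSpace ℝ (Fin 3),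
      YBound F R₁ → (∀ y, ‖y‖ ≤ L' → ‖F y‖ ≤ δ₀) → ∀ y, ‖y‖ ≤ L → ‖Rm π.1 π.2 F y‖ ≤ t := by
    intro R₁ L t ht
    obtain ⟨L', δ₀, hδ₀, h⟩ := h3 R₁ L t ht
    exact ⟨L', δ₀, hδ₀, fun π hπ F hF hsm => (h π.1 (hSm π hπ).1 π.2 (hSm π hπ).2 F hF hsm).2.2.2⟩
  have hR4 : ∀ π ∈ S, ∀ (F : EuclideanSpace ℝ (Fin 3) → EuclideanSpace ℝ (Fin 3)) (R₁ L t : ℝ), YBound F R₁ → 0 < t →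
      ∃ δ > 0, ∀ π' ∈ S, dist π' π < δ → ∀ y, ‖y‖ ≤ L → ‖Rm π'.1 π'.2 F y - Rm π.1 π.2 F y‖ ≤ t := by
    intro π hπ F R₁ L t hF ht
    obtain ⟨δ', hδ', h⟩ := h4 π.1 (hSm π hπ).1 π.2 (hSm π hπ).2 F R₁ L t hF ht
    exact ⟨δ', hδ', fun π' hπ' hd => (h π'.1 (hSm π' hπ').1 π'.2 (hSm π' hπ').2 (dist_cubeWindow_lt hd).1 (dist_cubeWindow_lt hd).2).2.2.2⟩
  have hNtight := fun R₀ L t (ht : 0 < t) => neumann_tight (S := S) (Rm := fun π => Rm π.1 π.2) hR1 hR2 hθ hR3 (Nop := Nop) hN1 hN2 R₀ L t ht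
  have hNloc := fun π (hπ : π ∈ S) F R₀ (hF : YBound F R₀) L t (ht : 0 < t) =>
    neumann_locClose (S := S) (Rm := fun π => Rm π.1 π.2) hR1 hR2 hθ hR3 hR4 (Nop := Nop) hN1 hN2 hπ hF L t ht
  -- THE GATE, with its Neumann operator EXPOSED
  refine ⟨Nop, fun p hp β hβ F R hF => hN1 _ (hSm' p β hp hβ) F R hF, ?_, ?_, ?_⟩
  · -- clauses (1) and (2) at every parameter
    intro p hp β hβ
    have hπ : ((p, β) : (Fin N → ℝ) × ℝ) ∈ S := hSm' p β hp hβ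
    refine ⟨fun F R hF => ?_, fun F H s hF hH => ?_⟩
    · have hR : 0 ≤ R := hF.nonneg
      have hNF : YBound (Nop (p, β) F) (2 * R) := hN1 _ hπ F R hF
      obtain ⟨hX, hQ1, hQb, hbb, hcb, hdiv, -, hid⟩ := h1 p hp β hβ _ _ hNF
      have hAR : A * (2 * R) ≤ C₂ * Γ ^ κ * R := by nlinarith
      refine ⟨hX.mono hAR, hQ1, fun y => (hQb y).trans hAR, hbb.trans hAR, fun j => (hcb j).trans hAR, hdiv, fun y => ?_⟩
      have h := hid y
      have e : Nop (p, β) F y = F y + Rm p β (Nop (p, β) F) y := hN2 _ hπ F R hF y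
      rw [e] at h
      exact add_right_cancel h
    · have hlin := hNlin _ hπ F H s hF hH
      obtain ⟨R, hFR⟩ := hF
      obtain ⟨R', hHR⟩ := hH
      have hNF : YBound (Nop (p, β) F) (2 * R) := hN1 _ hπ F R hFR
      have hNH : YBound (Nop (p, β) H) (2 * R') := hN1 _ hπ H R' hHR
      obtain ⟨hK, hb, hc, -⟩ := h2 p hp β hβ _ _ s ⟨_, hNF⟩ ⟨_, hNH⟩
      show (K₀ p β (Nop (p, β) (fun y => F y + s • H y)) = fun y => K₀ p β (Nop (p, β) F) y + s • K₀ p β (Nop (p, β) H) y) ∧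
        𝓫₀ p β (Nop (p, β) (fun y => F y + s • H y)) = 𝓫₀ p β (Nop (p, β) F) + s * 𝓫₀ p β (Nop (p, β) H) ∧
        ∀ j, 𝓬₀ p β (Nop (p, β) (fun y => F y + s • H y)) j = 𝓬₀ p β (Nop (p, β) F) j + s * 𝓬₀ p β (Nop (p, β) H) j
      rw [hlin]
      exact ⟨hK, hb, hc⟩
  · -- clause (3): tightness, uniformly on the box
    intro R L ε hε
    obtain ⟨L₁, δ₁, hδ₁, h3'⟩ := h3 (2 * R) L ε hε
    obtain ⟨L', δ₀, hδ₀, hN⟩ := hNtight R L₁ δ₁ hδ₁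
    refine ⟨L', δ₀, hδ₀, fun p hp β hβ F hF hsm => ?_⟩
    have hπ : ((p, β) : (Fin N → ℝ) × ℝ) ∈ S := hSm' p β hp hβ
    have hNF : YBound (Nop (p, β) F) (2 * R) := hN1 _ hπ F R hF
    have hNsm : ∀ y, ‖y‖ ≤ L₁ → ‖Nop (p, β) F y‖ ≤ δ₁ := hN _ hπ F hF hsm
    obtain ⟨hK, hb, hc, -⟩ := h3' p hp β hβ _ hNF hNsm
    exact ⟨hK, hb, hc⟩
  · -- clause (4): local continuity in `(p, β)` at fixed data
    intro p hp β hβ F R L ε hF hε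
    have hπ : ((p, β) : (Fin N → ℝ) × ℝ) ∈ S := hSm' p β hp hβ
    have hNF : YBound (Nop (p, β) F) (2 * R) := hN1 _ hπ F R hF
    -- (a) tightness for the difference `d = N′F − NF` (Y ≤ 2(θ2R + θ2R)), target ε/2 on `L`
    obtain ⟨L₁, δ₁, hδ₁, h3'⟩ := h3 (2 * (θ * (2 * R) + θ * (2 * R))) L (ε / 2) (by positivity)
    obtain ⟨δa, hδa, hNa⟩ := hNloc _ hπ F R hF L₁ δ₁ hδ₁
    -- (b) local continuity of the approximate pieces at the datum `N F`, target ε/2 on `L`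
    obtain ⟨δb, hδb, h4'⟩ := h4 p hp β hβ (Nop (p, β) F) (2 * R) L (ε / 2) hNF (by positivity)
    refine ⟨min δa δb, lt_min hδa hδb, fun p' hp' β' hβ' hdp hdβ => ?_⟩
    have hπ' : ((p', β') : (Fin N → ℝ) × ℝ) ∈ S := hSm' p' β' hp' hβ'
    have hdist : dist ((p', β') : (Fin N → ℝ) × ℝ) (p, β) < min δa δb := by
      rw [Prod.dist_eq, max_lt_iff]
      refine ⟨hdp, ?_⟩
      show dist β' β < min δa δb
      rw [Real.dist_eq]; exact hdβ
    have hda : dist ((p', β') : (Fin N → ℝ) × ℝ) (p, β) < δa := hdist.trans_le (min_le_left _ _)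
    have hdb1 : dist p' p < δb := hdp.trans_le (min_le_right _ _)
    have hdb2 : |β' - β| < δb := hdβ.trans_le (min_le_right _ _)
    obtain ⟨hdsmall, hdY⟩ := hNa (p', β') hπ' hda
    set d : EuclideanSpace ℝ (Fin 3) → EuclideanSpace ℝ (Fin 3) := fun y => Nop (p', β') F y - Nop (p, β) F y with hdd
    obtain ⟨hKd, hbd, hcd, -⟩ := h3' p' hp' β' hβ' d hdY hdsmall
    obtain ⟨hK4, hb4, hc4, -⟩ := h4' p' hp' β' hβ' hdb1 hdb2
    have hNF' : YBound (Nop (p', β') F) (2 * R) := hN1 _ hπ' F R hF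
    obtain ⟨hlinK', hlinb', hlinc', -⟩ := h2 p' hp' β' hβ' (Nop (p, β) F) d 1 ⟨_, hNF⟩ ⟨_, hdY⟩
    have eF : (fun y => Nop (p, β) F y + (1:ℝ) • d y) = Nop (p', β') F := by funext y; simp [hdd]
    rw [eF] at hlinK' hlinb' hlinc'
    -- X-bounds of the pieces (for differentiability of the split)
    have hX1 : XBound (K₀ p' β' (Nop (p, β) F)) (A * (2 * R)) := (h1 p' hp' β' hβ' _ _ hNF).1
    have hX2 : XBound (K₀ p' β' d) (A * (2 * (θ * (2 * R) + θ * (2 * R)))) := (h1 p' hp' β' hβ' _ _ hdY).1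
    refine ⟨fun y hy => ⟨?_, ?_⟩, ?_, fun j => ?_⟩
    · -- values
      have e : K₀ p' β' (Nop (p', β') F) y = K₀ p' β' (Nop (p, β) F) y + K₀ p' β' d y := by
        rw [hlinK']; simp
      obtain ⟨h4v, -⟩ := hK4 y hy
      obtain ⟨hdv, -⟩ := hKd y hy
      calc ‖K₀ p' β' (Nop (p', β') F) y - K₀ p β (Nop (p, β) F) y‖
          = ‖(K₀ p' β' (Nop (p, β) F) y - K₀ p β (Nop (p, β) F) y) + K₀ p' β' d y‖ := by rw [e]; congr 1; abel
        _ ≤ ‖K₀ p' β' (Nop (p, β) F) y - K₀ p β (Nop (p, β) F) y‖ + ‖K₀ p' β' d y‖ := norm_add_le _ _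
        _ ≤ ε / 2 + ε / 2 := add_le_add h4v hdv
        _ = ε := by ring
    · -- derivatives
      have e : K₀ p' β' (Nop (p', β') F) = fun y => K₀ p' β' (Nop (p, β) F) y + K₀ p' β' d y := by
        rw [hlinK']; funext y; simp
      have eD : fderiv ℝ (K₀ p' β' (Nop (p', β') F)) y = fderiv ℝ (K₀ p' β' (Nop (p, β) F)) y + fderiv ℝ (K₀ p' β' d) y := by
        rw [e]; exact fderiv_fun_add (hX1.1.differentiable (by norm_num) y) (hX2.1.differentiable (by norm_num) y)
      obtain ⟨-, h4D⟩ := hK4 y hy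
      obtain ⟨-, hdD⟩ := hKd y hy
      calc ‖fderiv ℝ (K₀ p' β' (Nop (p', β') F)) y - fderiv ℝ (K₀ p β (Nop (p, β) F)) y‖
          = ‖(fderiv ℝ (K₀ p' β' (Nop (p, β) F)) y - fderiv ℝ (K₀ p β (Nop (p, β) F)) y) + fderiv ℝ (K₀ p' β' d) y‖ := by rw [eD]; congr 1; abel
        _ ≤ ‖fderiv ℝ (K₀ p' β' (Nop (p, β) F)) y - fderiv ℝ (K₀ p β (Nop (p, β) F)) y‖ + ‖fderiv ℝ (K₀ p' β' d) y‖ := norm_add_le _ _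
        _ ≤ ε / 2 + ε / 2 := add_le_add h4D hdD
        _ = ε := by ring
    · -- the rate functional
      have e : 𝓫₀ p' β' (Nop (p', β') F) = 𝓫₀ p' β' (Nop (p, β) F) + 𝓫₀ p' β' d := by rw [hlinb']; simp
      calc |𝓫₀ p' β' (Nop (p', β') F) - 𝓫₀ p β (Nop (p, β) F)|
          = |(𝓫₀ p' β' (Nop (p, β) F) - 𝓫₀ p β (Nop (p, β) F)) + 𝓫₀ p' β' d| := by rw [e]; congr 1; ring
        _ ≤ |𝓫₀ p' β' (Nop (p, β) F) - 𝓫₀ p β (Nop (p, β) F)| + |𝓫₀ p' β' d| := abs_add_le _ _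
        _ ≤ ε / 2 + ε / 2 := add_le_add hb4 hbd
        _ = ε := by ring
    · -- the accretion functionals
      have e : 𝓬₀ p' β' (Nop (p', β') F) j = 𝓬₀ p' β' (Nop (p, β) F) j + 𝓬₀ p' β' d j := by rw [hlinc' j]; simp
      calc |𝓬₀ p' β' (Nop (p', β') F) j - 𝓬₀ p β (Nop (p, β) F) j|
          = |(𝓬₀ p' β' (Nop (p, β) F) j - 𝓬₀ p β (Nop (p, β) F) j) + 𝓬₀ p' β' d j| := by rw [e]; congr 1; ring
        _ ≤ |𝓬₀ p' β' (Nop (p, β) F) j - 𝓬₀ p β (Nop (p, β) F) j| + |𝓬₀ p' β' d j| := abs_add_le _ _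
        _ ≤ ε / 2 + ε / 2 := add_le_add (hc4 j) (hcd j)
        _ = ε := by ring


end Summit.NavierStokesRegularity.NavierStokesRegularity.Theorems.DefectColumnGate

end
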